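import Summits.HubbardSuperconductivity.ManyBodyBootstrap.Bounds.E2.Defs
import Literature.MathematicalPhysics.QuantumLattice.HeisenbergRPCorrelationBlocks
import Literature.MathematicalPhysics.QuantumLattice.HeisenbergOrderNeelGD
import Literature.MathematicalPhysics.QuantumLattice.HeisenbergOrderNeelShortRange
import HarnessLib

/-!
# Glue: torus-family energy ceiling ⇒ nearest-neighbour correlation ceiling, uniformly in the side `2k`

HONEST FRAMING: ladder R1–R4 with certified numbers; no claim on H/H₀.

If `E₀(L') ≤ q·L'²` for every even `L' ≥ 6` (`HeisTorusFamilyUpper 2 6 q` of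
`ManyBodyBootstrap/Bounds/E2/Defs` — the head shape of the kernel-certified variational bound
`Bounds.heisTL_fdc_upper_2x2`, LEAN FILING REQUEST #219), then for every `k ≥ 3` the translation- and
`D₄`-reduced nearest-neighbour ground-state correlation of the spin-½ Heisenberg antiferromagnet on the
`2k × 2k` torus obeys `c_{2k}(0,1) ≤ q/6` (`ε = E₀/(3·2·L²)`, `heisBondCorr_eq_groundEnergy_div`; translation
invariance `heisBondCorr_two_eq`; `c(1,0) = c(0,1)`, `heisRedCorr2_swap`).  This is the `k`-uniform version of the
landed finite-side copies `heisRedCorr2_01_le_of_familyUpper_eight/_ten/_twelve/_sixteen`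
(`NeelRPCeilingCorrelationRows{Eight,Ten,Twelve,Sixteen}A`); it is the energy input of the `L`-uniform sign rows.
[folklore]
-/

noncomputable section

open Finset Matrix Literature.MathematicalPhysics.QuantumLattice Literature.Probability.LatticeModels

namespace Summit.HubbardSuperconductivity.HubbardLadder

/-- **Energy ceiling ⇒ nearest-neighbour correlation ceiling**, uniformly in the side: from
`HeisTorusFamilyUpper 2 6 q` (i.e. `E₀(L') ≤ q·L'²` for all even `L' ≥ 6`), `c_{2k}(0,1) ≤ q/6` for every `k ≥ 3`. [folklore] -/
theorem heisRedCorr2_01_le_of_familyUpper {q : ℚ}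
    (hU : Summit.HubbardSuperconductivity.ManyBodyBootstrap.Bounds.E2.HeisTorusFamilyUpper 2 6 q)
    (k : ℕ) (hk : 3 ≤ k) :
    heisRedCorr2 (2 * k) 1 0 1 ≤ (q : ℝ) / 6 := by
  haveI : NeZero (2 * k) := ⟨by omega⟩
  have hk2 : 2 ≤ k := le_trans (by norm_num) hk
  have hE : (heisenbergTorus 2 (2 * k) 1 1).groundEnergy ≤ (q : ℝ) * ((2 * k : ℕ) : ℝ) ^ 2 :=
    hU (2 * k) (Dvd.intro k rfl) (by omega)
  have hε2 := heisBondCorr_two_eq (2 * k) 1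
  have hεE := heisBondCorr_eq_groundEnergy_div (d := 2) (by norm_num) 1 k hk2
  rw [heisRedCorr2_swap (2 * k) 1 1 0] at hε2
  have hkpos : (0 : ℝ) < ((2 * k : ℕ) : ℝ) := by
    have : (0 : ℕ) < 2 * k := by omega
    exact_mod_cast this
  have hLpos : (0 : ℝ) < ((2 * k : ℕ) : ℝ) ^ 2 := by positivity
  have e0 : heisRedCorr2 (2 * k) 1 0 1 =
      (heisenbergTorus 2 (2 * k) 1 1).groundEnergy / (6 * ((2 * k : ℕ) : ℝ) ^ 2) := by
    have h := hε2.symm.trans hεE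
    have e6 : (3 * ((2 : ℕ) : ℝ) * ((2 * k : ℕ) : ℝ) ^ 2) = 6 * ((2 * k : ℕ) : ℝ) ^ 2 := by
      push_cast; ring
    rw [e6] at h
    linarith
  have hne0 : (6 * ((2 * k : ℕ) : ℝ) ^ 2) ≠ 0 := by positivity
  have h6 : heisRedCorr2 (2 * k) 1 0 1 * (6 * ((2 * k : ℕ) : ℝ) ^ 2) =
      (heisenbergTorus 2 (2 * k) 1 1).groundEnergy := by
    rw [e0]; exact div_mul_cancel₀ _ hne0
  rw [le_div_iff₀ (by norm_num : (0 : ℝ) < 6)]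
  have h' : heisRedCorr2 (2 * k) 1 0 1 * 6 * ((2 * k : ℕ) : ℝ) ^ 2 ≤ (q : ℝ) * ((2 * k : ℕ) : ℝ) ^ 2 := by
    rw [mul_assoc, h6]; exact hE
  exact le_of_mul_le_mul_right h' hLpos

end Summit.HubbardSuperconductivity.HubbardLadder

end
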